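import Literature.AlgebraicGeometry.KTheory.TruncLEVectorBundle
import Literature.AlgebraicGeometry.Modules.BoundedCoherentVBModels
import Literature.AlgebraicGeometry.Modules.QuasicoherentAbelian
import Literature.AlgebraicGeometry.Modules.StrictlyPerfectResolution
import Mathlib.Algebra.Homology.DerivedCategory.FullyFaithful
import Mathlib.Algebra.Homology.DerivedCategory.Plus
import HarnessLib

/-!
# A vector-bundle model with cohomology in one degree is a strictly perfect RESOLUTION; on a complex abelian variety every
# coherent sheaf has a finite locally free resolution, from [Thomason–Trobaugh 2.3.1 (d) ∧ SGA 6 II 2.2.2.1] as typed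

Layer `Literature/AlgebraicGeometry/Modules` (0 NEW named facts, no instances). Sequel to `Modules/StrictlyPerfectResolution` (the
carrier `StrictlyPerfectResolution E`: a bounded complex of vector bundles in degrees `≤ 0` with a quasi-isomorphism to `E[0]`; its
«What is NOT here: existence») and `KTheory/TruncLEVectorBundle` (the canonical truncation of a bounded VB complex at its top cohomology
degree is a bounded VB complex).

* §1 `StrictlyPerfectResolution.ofVBModel` — a bounded complex `K` of finite locally free `𝒪_X`-modules on ANY scheme `X` whose cohomology
  is concentrated in degree `0` (Mathlib `K.IsLE 0`, `K.IsGE 0`), with an isomorphism `H⁰(K) ≅ F`, yields a strictly perfect resolution of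
  `F`: `P := τ^{≤0} K = (⋯ → K⁻¹ → Z⁰(K) → 0)` (a VB complex, `IsBoundedVBComplex.truncLE`), augmented by `Z⁰ ↠ H⁰(K) ≅ F`; exactness in
  negative degrees is that of `K`. `StrictlyPerfectResolution.ofDerivedIso` — the same from an isomorphism
  `Q K ≅ F[0]` in the DERIVED category `D(Mod 𝒪_X)` (`DerivedCategory.singleFunctor`): amplitude and `H⁰` are read off through
  `DerivedCategory.homologyFunctor` (`isLE_Q_obj_iff`, `homologyFunctorFactors`, `singleFunctorCompHomologyFunctorIso`). So a derived-level
  vector-bundle MODEL of a single sheaf is already a chain-level RESOLUTION of it.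
* §2 **`nonempty_strictlyPerfectResolution_of_coh`** — under the tree's displayed fact [SP]
  `ThomasonTrobaugh_vbModel_of_boundedCoh` AS TYPED (every object of `D⁺(Mod 𝒪_B)` with bounded coherent cohomology on a complex
  abelian variety `B` is the class of a bounded VB complex), EVERY coherent `𝒪_B`-module `F` (the tree's affine-local `Morphisms.Coh`)
  admits a `StrictlyPerfectResolution` (apply [SP] to `F[0] ∈ D⁺`, whose cohomology is `F` in degree `0` and `0` elsewhere, then §1);
  `exists_epi_of_isFiniteLocallyFree_of_coh` — in particular every coherent sheaf on `B` is a quotient of a vector bundle (the resolution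
  property). On a complex abelian variety this is Hartshorne III Ex. 6.8–6.9 (a) (the tree's OTHER displayed fact
  `Hartshorne1977_exists_strictlyPerfectResolution`, stated for noetherian integral separated regular schemes) obtained from [SP] instead.

Typed for the cell `pub-hodge-ring2` (the inputs `R₀ᵢ : StrictlyPerfectResolution F₀ᵢ` of the box-resolution assembler exist from
`Coh F₀ᵢ` under the `hSP` already in its signature; first file of the (k3) lane «`χ`/`ch` of a bounded VB complex depends only on its
derived class»). A research route conditional on HC_CM, not a corollary — nothing in this file refers to it. No instance, no notation,
no `sorry`.

## References

* R. W. Thomason, T. Trobaugh, *Higher algebraic K-theory of schemes and of derived categories* (1990), Prop. 2.3.1 (d), 2.2.x.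
  [ThomasonTrobaugh1990]
* P. Berthelot, A. Grothendieck, L. Illusie, *SGA 6*, Exp. II Cor. 2.2.2.1. [SGA6]
* R. Hartshorne, *Algebraic Geometry* (1977), III Ex. 6.8, Ex. 6.9 (a) (finite locally free resolutions on regular schemes). [Hartshorne1977]
* C. A. Weibel, *An introduction to homological algebra* (1994), Def. 2.2.4, Exercise 2.2.3 (a resolution is a quasi-isomorphism to
  `M[0]`), 1.2.7–1.2.8 (truncations). [Weibel1994]
* D. Huybrechts, *Fourier–Mukai transforms in algebraic geometry* (2006), Prop. 3.26. [HuybrechtsFM2006]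
-/

noncomputable section

universe w u

open CategoryTheory CategoryTheory.Limits AlgebraicGeometry ZeroObject

namespace Literature.AlgebraicGeometry.Modules

open Literature.AlgebraicGeometry.KTheory Literature.AlgebraicGeometry.Motives Literature.AlgebraicGeometry.Morphisms

/-! ### §1 A vector-bundle model with cohomology in degree `0` is a resolution -/

section OfVBModel

variable {X : Scheme.{u}} (K : CochainComplex X.Modules ℤ) {F : X.Modules}

/-- `τ^{≤0} K` has no differential out of degree `0`. [cite: Weibel1994, 1.2.7 (truncations)] -/
theorem truncLE_zero_d_zero_one : (K.truncLE 0).d 0 1 = 0 :=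
  ((K.truncLE 0).isZero_of_isStrictlyLE 0 1 (by norm_num)).eq_of_tgt _ _

/-- The augmentation `(τ^{≤0} K)⁰ = Z⁰(K) ↠ H⁰(τ^{≤0} K) ≅ H⁰(K) ≅ F` in degree `0`. [cite: Weibel1994, Def. 2.2.4 and Exercise 2.2.3] -/
def augmentationOfVBModel (e : K.homology 0 ≅ F) : (K.truncLE 0).X 0 ⟶ F :=
  ((K.truncLE 0).iCyclesIso 0 1 (by simp) (truncLE_zero_d_zero_one K)).inv ≫ (K.truncLE 0).homologyπ 0 ≫
    (isoOfQuasiIsoAt (K.ιTruncLE 0) 0).hom ≫ e.hom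

/-- `d⁻¹` followed by the augmentation vanishes. [cite: Weibel1994, Def. 2.2.4 and Exercise 2.2.3] -/
theorem d_comp_augmentationOfVBModel (e : K.homology 0 ≅ F) :
    (K.truncLE 0).d (-1) 0 ≫ augmentationOfVBModel K e = 0 := by
  have h : (K.truncLE 0).d (-1) 0 ≫ ((K.truncLE 0).iCyclesIso 0 1 (by simp) (truncLE_zero_d_zero_one K)).inv =
      (K.truncLE 0).toCycles (-1) 0 := by
    rw [← cancel_mono ((K.truncLE 0).iCyclesIso 0 1 (by simp) (truncLE_zero_d_zero_one K)).hom, Category.assoc,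
      Iso.inv_hom_id, Category.comp_id, HomologicalComplex.iCyclesIso_hom, HomologicalComplex.toCycles_i]
  rw [augmentationOfVBModel, ← Category.assoc, h, HomologicalComplex.toCycles_comp_homologyπ_assoc, zero_comp]

/-- The augmentation is an epimorphism. [cite: Weibel1994, Def. 2.2.4 and Exercise 2.2.3] -/
theorem epi_augmentationOfVBModel (e : K.homology 0 ≅ F) : Epi (augmentationOfVBModel K e) := by
  unfold augmentationOfVBModel
  infer_instance

/-- `(τ^{≤0}K)⁻¹ → (τ^{≤0}K)⁰ → F` is exact (`H⁰` is the cokernel of `K⁻¹ → Z⁰`). [cite: Weibel1994, Def. 2.2.4 and Exercise 2.2.3] -/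
theorem exact_augmentationOfVBModel (e : K.homology 0 ≅ F) :
    (ShortComplex.mk _ _ (d_comp_augmentationOfVBModel K e)).Exact := by
  have h₀ : (ShortComplex.mk ((K.truncLE 0).toCycles (-1) 0) ((K.truncLE 0).homologyπ 0)
      ((K.truncLE 0).toCycles_comp_homologyπ (-1) 0)).Exact :=
    ShortComplex.exact_of_g_is_cokernel _ ((K.truncLE 0).homologyIsCokernel (-1) 0 (by simp))
  refine (ShortComplex.exact_iff_of_iso ?_).1 h₀
  refine ShortComplex.isoMk (Iso.refl _) ((K.truncLE 0).iCyclesIso 0 1 (by simp) (truncLE_zero_d_zero_one K))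
    (isoOfQuasiIsoAt (K.ιTruncLE 0) 0 ≪≫ e) ?_ ?_
  · simp
  · simp [augmentationOfVBModel]

/-- `τ^{≤0} K` is exact in negative degrees when `K` is. [cite: Weibel1994, 1.2.7 (truncations)] -/
theorem exactAt_truncLE_zero_of_neg [K.IsGE 0] (i : ℤ) (hi : i < 0) : (K.truncLE 0).ExactAt i := by
  haveI : QuasiIsoAt (K.ιTruncLE 0) i := K.quasiIsoAt_ιTruncLE 0 i hi.le
  exact (exactAt_iff_of_quasiIsoAt (K.ιTruncLE 0) i).2 (K.exactAt_of_isGE 0 i hi)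

variable {K}

/-- **A vector-bundle model with cohomology concentrated in degree `0` is a strictly perfect resolution of its `H⁰`:** for a bounded
complex `K` of finite locally free modules with `K` cohomologically `≤ 0` and `≥ 0` and `e : H⁰(K) ≅ F`, the truncation
`τ^{≤0} K = (⋯ → K⁻¹ → Z⁰ → 0)` augmented by `Z⁰ ↠ H⁰(K) ≅ F` is an exact sequence `0 → K⁻ⁿ → ⋯ → K⁻¹ → Z⁰ → F → 0` of vector bundles
(`Z⁰` is a vector bundle: `IsBoundedVBComplex.truncLE`). [cite: Weibel1994, Def. 2.2.4 and Exercise 2.2.3] [cite: ThomasonTrobaugh1990, 2.2.x (truncations of strict perfect complexes)] -/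
def StrictlyPerfectResolution.ofVBModel (hK : IsBoundedVBComplex K) [K.IsLE 0] [K.IsGE 0] (e : K.homology 0 ≅ F) :
    StrictlyPerfectResolution F :=
  StrictlyPerfectResolution.mk' (K.truncLE 0) (hK.truncLE 0) (augmentationOfVBModel K e) (d_comp_augmentationOfVBModel K e)
    (exactAt_truncLE_zero_of_neg K) (exact_augmentationOfVBModel K e) (epi_augmentationOfVBModel K e)

/-- The resolving complex of `ofVBModel` is `τ^{≤0} K`. [cite: Weibel1994, Def. 2.2.4] -/
@[simp]
theorem StrictlyPerfectResolution.ofVBModel_P (hK : IsBoundedVBComplex K) [K.IsLE 0] [K.IsGE 0] (e : K.homology 0 ≅ F) :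
    (StrictlyPerfectResolution.ofVBModel hK e).P = K.truncLE 0 := rfl

variable [HasDerivedCategory.{w} X.Modules]

/-- A complex whose class in `D(Mod 𝒪_X)` is that of `F[0]` is cohomologically `≤ 0`. [cite: Weibel1994, 10.4 (the derived category)] -/
theorem isLE_zero_of_iso_single (e : DerivedCategory.Q.obj K ≅ (DerivedCategory.singleFunctor X.Modules 0).obj F) : K.IsLE 0 := by
  haveI : (DerivedCategory.Q.obj K).IsLE 0 := DerivedCategory.TStructure.t.isLE_of_iso e.symm 0
  exact (DerivedCategory.isLE_Q_obj_iff K 0).1 inferInstance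

/-- A complex whose class in `D(Mod 𝒪_X)` is that of `F[0]` is cohomologically `≥ 0`. [cite: Weibel1994, 10.4 (the derived category)] -/
theorem isGE_zero_of_iso_single (e : DerivedCategory.Q.obj K ≅ (DerivedCategory.singleFunctor X.Modules 0).obj F) : K.IsGE 0 := by
  haveI : (DerivedCategory.Q.obj K).IsGE 0 := DerivedCategory.TStructure.t.isGE_of_iso e.symm 0
  exact (DerivedCategory.isGE_Q_obj_iff K 0).1 inferInstance

/-- `H⁰(K) ≅ F` from an isomorphism `Q K ≅ F[0]` in `D(Mod 𝒪_X)` (through `DerivedCategory.homologyFunctor`).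
[cite: Weibel1994, 10.4 (the derived category)] -/
def homologyZeroIsoOfIsoSingle (e : DerivedCategory.Q.obj K ≅ (DerivedCategory.singleFunctor X.Modules 0).obj F) :
    K.homology 0 ≅ F :=
  ((DerivedCategory.homologyFunctorFactors X.Modules 0).app K).symm ≪≫ (DerivedCategory.homologyFunctor X.Modules 0).mapIso e ≪≫
    (DerivedCategory.singleFunctorCompHomologyFunctorIso X.Modules 0).app F

/-- **A vector-bundle MODEL of `F[0]` in the derived category is a strictly perfect RESOLUTION of `F`:** for a bounded complex `K` of finite
locally free modules with `Q K ≅ F[0]` in `D(Mod 𝒪_X)`, the truncation `τ^{≤0} K`, augmented through `H⁰(K) ≅ F`, resolves `F`.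
[cite: ThomasonTrobaugh1990, Prop. 2.3.1 (d) and 2.2.x] [cite: Weibel1994, Exercise 2.2.3] -/
def StrictlyPerfectResolution.ofDerivedIso (hK : IsBoundedVBComplex K)
    (e : DerivedCategory.Q.obj K ≅ (DerivedCategory.singleFunctor X.Modules 0).obj F) : StrictlyPerfectResolution F :=
  haveI := isLE_zero_of_iso_single e
  haveI := isGE_zero_of_iso_single e
  StrictlyPerfectResolution.ofVBModel hK (homologyZeroIsoOfIsoSingle e)

/-- The resolving complex of `ofDerivedIso` is `τ^{≤0} K`. [cite: Weibel1994, Def. 2.2.4] -/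
@[simp]
theorem StrictlyPerfectResolution.ofDerivedIso_P (hK : IsBoundedVBComplex K)
    (e : DerivedCategory.Q.obj K ≅ (DerivedCategory.singleFunctor X.Modules 0).obj F) :
    (StrictlyPerfectResolution.ofDerivedIso hK e).P = K.truncLE 0 := rfl

end OfVBModel

/-! ### §2 On a complex abelian variety: every coherent sheaf has a finite locally free resolution, from [SP] -/

section AbelianVariety

variable {X : Scheme.{u}}

/-- A zero `𝒪_X`-module is coherent. [cite: Hartshorne1977, II Prop. 5.7] -/
theorem coh_of_isZero' {Z : X.Modules} (hZ : IsZero Z) : Coh Z := by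
  refine ⟨IsAffineLocalizing.of_isZero hZ,
    IsAffineFiniteType.of_app_surjective (0 : unitModule X ⟶ Z) (fun V _ n => ⟨0, ?_⟩) IsAffineFiniteType.unit⟩
  have h1 : (𝟙 Z : Z ⟶ Z) = 0 := hZ.eq_of_src _ _
  have hn : n = 0 := by
    have h2 := congrArg (fun φ : Z ⟶ Z => φ.app V n) h1
    simpa [Scheme.Modules.Hom.id_app, Scheme.Modules.Hom.zero_app] using h2
  rw [hn, map_zero]

/-- Coherence is invariant under isomorphisms. [cite: Hartshorne1977, II Prop. 5.7] -/
theorem coh_of_iso' {M N : X.Modules} (e : M ≅ N) (hM : Coh M) : Coh N :=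
  ⟨IsAffineLocalizing.of_iso e hM.loc, IsAffineFiniteType.of_iso e hM.ft⟩

variable (B : AbelianVariety ℂ) [HasDerivedCategory.{w} B.X.left.Modules]

/-- The cohomology sheaves of `F[0] ∈ D⁺(Mod 𝒪_B)` are coherent when `F` is: `F` in degree `0`, zero elsewhere.
[cite: HuybrechtsFM2006, Prop. 3.26 (D^b(Coh) inside D(Mod))] -/
theorem coh_homology_singleFunctor_plus {F : B.X.left.Modules} (hF : Coh F) (k : ℤ) :
    Coh ((DerivedCategory.Plus.homologyFunctor B.X.left.Modules k).obj
      ((DerivedCategory.Plus.singleFunctor B.X.left.Modules 0).obj F)) := by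
  rcases lt_trichotomy k 0 with hk | rfl | hk
  · exact coh_of_isZero' (DerivedCategory.Plus.isZero_homology_of_isGE _ 0 k hk)
  · exact coh_of_iso' ((DerivedCategory.singleFunctorCompHomologyFunctorIso B.X.left.Modules 0).app F).symm hF
  · exact coh_of_isZero' (DerivedCategory.Plus.isZero_homology_of_isLE _ 0 k hk)

/-- **On a complex abelian variety every coherent sheaf has a finite locally free resolution — from [SP] as typed.** Under the tree's
displayed fact `ThomasonTrobaugh_vbModel_of_boundedCoh` ([Thomason–Trobaugh 2.3.1 (d)] ∧ regularity ∧ [SGA 6 II 2.2.2.1], typed on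
`D⁺(Mod 𝒪_B)`), the object `F[0]` of `D⁺` (cohomology `F` in degree `0`, coherent, bounded) is the class of a bounded VB complex `K`; the
resulting DERIVED isomorphism `Q K ≅ F[0]` makes `τ^{≤0} K → F` a strictly perfect resolution (§1). This is Hartshorne III Ex. 6.9 (a) on `B`,
obtained from [SP] instead of Kleiman + Serre. [cite: ThomasonTrobaugh1990, Prop. 2.3.1 (d)] [cite: SGA6, Exp. II Cor. 2.2.2.1]
[cite: Hartshorne1977, III Ex. 6.9 (a) (p. 238)] -/
theorem nonempty_strictlyPerfectResolution_of_coh (hSP : ThomasonTrobaugh_vbModel_of_boundedCoh.{w}) {F : B.X.left.Modules}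
    (hF : Coh F) : Nonempty (StrictlyPerfectResolution F) := by
  obtain ⟨K, hK, n, hn, ⟨e⟩⟩ := hSP B ((DerivedCategory.Plus.singleFunctor B.X.left.Modules 0).obj F) 0 0 inferInstance inferInstance
    (coh_homology_singleFunctor_plus B hF)
  -- the derived isomorphism `Q K ≅ F[0]` in `D(Mod 𝒪_B)` under the inclusion `D⁺ ⥤ D`
  let e' : DerivedCategory.Q.obj K ≅ (DerivedCategory.singleFunctor B.X.left.Modules 0).obj F :=
    ((DerivedCategory.quotientCompQhIso B.X.left.Modules).app K).symm ≪≫ DerivedCategory.Plus.ι.mapIso e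
  exact ⟨StrictlyPerfectResolution.ofDerivedIso hK e'⟩

/-- **The resolution property on a complex abelian variety, from [SP]:** every coherent sheaf is a quotient of a finite locally free
module (the degree-`0` part of the resolution). [cite: Hartshorne1977, III Ex. 6.8 (p. 238)] [cite: ThomasonTrobaugh1990, Prop. 2.3.1 (d)] -/
theorem exists_epi_of_isFiniteLocallyFree_of_coh (hSP : ThomasonTrobaugh_vbModel_of_boundedCoh.{w}) {F : B.X.left.Modules}
    (hF : Coh F) : ∃ (E : B.X.left.Modules) (π : E ⟶ F), IsFiniteLocallyFree E ∧ Epi π := by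
  obtain ⟨R⟩ := nonempty_strictlyPerfectResolution_of_coh B hSP hF
  exact ⟨R.P.X 0, R.π, R.isFiniteLocallyFree 0, R.epi_π⟩

end AbelianVariety

end Literature.AlgebraicGeometry.Modules

end
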